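import Summits.QuantumFields.YangMills.Theorems.BalabanUVNodesN15KingModelAnalyticDeterminantRealSlice
import Summits.QuantumFields.YangMills.Theorems.BalabanUVNodesN15KingModelFineFluctuationDensity
import HarnessLib

/-!
# BalabanUVNodes ∕ N15 — THE KING-MODEL RUNG (PART Ϭ-g): KING's `ln[Z(U)Z(1)⁻¹]` IS ASYMPTOTICALLY DIAMAGNETIC — the fine fluctuation normalisation WITH the block term, `det A₀(U) = a^{N}·det(−cΔ_U+m²)∕det Δ_eff(U)`
# (PART Ϭ-a), obeys at EVERY unitary background: `det(c(−Δ)+m²)^{|n|} ≤ det(−cΔ_U+m²) ≤ det A₀(U) ≤ (1+a∕m²)^{N}·det(−cΔ_U+m²)` (the block term raises the minimally coupled normalisation by at most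
# `ln(1+a∕m²)` PER BLOCK degree of freedom — it has rank `N`), hence ★★★★ `ln det A₀(U) − ln det A₀(1) ≥ −N·ln(1+a∕m²)`: the diamagnetic inequality of the minimally coupled operator ([BFS],
# PART Ͱ-c) survives the block term up to a BLOCK-extensive defect — per FINE site `≥ −|n|·L^{−(d+1)}·ln(1+a∕m²) = −|n|·η^{d+1}·ln(1+a∕m²)`, an η-RATE; and the ceiling
# `ln det A₀(U) − ln det A₀(1) ≤ |n||T_η|·ln(1+2(d+1)c∕m²) + N·ln(1+a∕m²)` (every period `≥ 2`)
# (Track A, DAG node N15 = NE2; FAN-OUT v1.1 §N15 s3 «KING-MODEL RUNG … + what the curved case adds»; count-neutral)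

HONEST FRAMING.  Count-neutral (cell `pub-ymgap`, seat `pub-ymgap-dag-n15-e` g53; `--supports stmt-QuantumFields-27247 --as helper` = K3ᴬ, KEY MAP v3).  King's one-level comparison model,
unitary backgrounds, any `RCLike` fibre field, `a, m² > 0`, `c ≥ 0`; the defect constant `ln(1+a∕m²)` per block dof is PART Ϭ-b's spectral window and is not claimed sharp; whether `det A₀(U) ≥ det A₀(1)`
holds exactly (full diamagnetism WITH the block term) is NOT decided here.  NOT Bałaban's multi-level `Z_k`; NOT a node discharge (N15 of record untouched); nothing continuum ∕ ℝ⁴ ∕ OS ∕ Clay.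

THE RESULTS (unitary `U`; `a, m² > 0`, `c ≥ 0`; `N = |T₁|·|n|`, `N_η = |T_η|·|n|`; `B(U) = −cΔ_U+m²`, `A₀(U) = B(U) + aQ(U)^*Q(U)`):
* §1 `re_det_covLapF_flat` (`det B(1) = det(c(−Δ)+m²)^{|n|}`), ★★ `log_re_det_covLapF_sub_flat_nonneg` (THE DIAMAGNETIC SHIFT IS NON-NEGATIVE: `0 ≤ ln det B(U) − ln det B(1)`, PART Ͱ-c by name),
  ★★ `log_re_det_covLapF_sub_flat_le` (periods `≥ 2`: `≤ N_η·ln(1+2(d+1)c∕m²)`).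
* §2 ★★★ **`log_re_det_fullOpU_ge_covLapF`** (`ln det B(U) ≤ ln det A₀(U)` — the block term only raises the normalisation), ★★★ **`log_re_det_fullOpU_le_covLapF_add`** (`ln det A₀(U) ≤ ln det B(U) + N·ln(1+a∕m²)`
  — by at most `ln(1+a∕m²)` per BLOCK dof), ★★ `log_re_det_fullOpU_ge_flat_covLapF` (`ln det A₀(U) ≥ |n|·ln det(c(−Δ)+m²)`).
* §3 ★★★★ **`king_logZ_sub_flat_ge`** (`ln det A₀(U) − ln det A₀(1) ≥ −N·ln(1+a∕m²)` — ASYMPTOTIC DIAMAGNETISM OF KING's FLUCTUATION NORMALISATION), ★★★★ **`king_logZ_sub_flat_div_card_ge`**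
  (per fine site: `(ln det A₀(U) − ln det A₀(1))∕|T_η| ≥ −|n|·(L^{d+1})⁻¹·ln(1+a∕m²)` — the defect is `O(η^{d+1})`), ★★★ **`king_logZ_sub_flat_le`** (periods `≥ 2`:
  `ln det A₀(U) − ln det A₀(1) ≤ N_η·ln(1+2(d+1)c∕m²) + N·ln(1+a∕m²)`), ★★★ **`abs_king_logZ_sub_flat_le`** (two-sided).
PRIOR TREE ART (by name): Ϭ-a (`log_re_det_effLapU_eq`, `king_logZ_split`, `re_det_fullOpU_pos`), Ϭ-b (`pow_le_re_det_effLapU`, `re_det_effLapU_le_pow`, `abs_log_re_det_effLapU_sub_le`), Ͱ-c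
(`det_lapF_pow_le_re_det_covLapF`, `re_det_covLapF_le_pow`, `re_det_covLapF_pos`), Ͱ-a (`det_covLapF_free`), Ε-k (`det_lapF_pos`, `log_det_lapF_bounds`), Ε-r (`card_tor_fine_real`; preflight `dedup.landed` caught a restated copy — deleted, imported), Ε-q (`det_fineOp_mul_det_effLaplacian`, the `U ≡ 1` identity; in scope, cited).  Dedup (rg at filing):
basename 0 files; needles `king_logZ_sub_flat_ge|king_logZ_sub_flat_div_card_ge|log_re_det_fullOpU_le_covLapF_add|log_re_det_fullOpU_ge_covLapF|abs_king_logZ_sub_flat_le` 0 tree files.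
Locators: [King1986] (2.6) p.652, (2.13)–(2.14) p.653, (3.89)–(3.90) pp.668–669, (4.4) p.670, (4.33) p.674; [Balaban1982Higgs2] (3.37)–(3.38) p.591; [BrydgesFrohlichSeiler1979] (diamagnetic inequality, via the tree's
`LatticeDiamagneticInequality`).  0 `sorry`, 0 `def`.  v1.1 (DOC-ONLY, ERRATUM-Ϭ2, ref-I READ-1094 N1): the title line now carries the «every period `≥ 2`» proviso (`hK2`) of the ceiling, as the
result list and the docstrings did; declarations byte-identical.
-/

noncomputable section
open scoped BigOperators ComplexConjugate ComplexOrder Matrix.Norms.L2Operator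
open Finset Matrix

namespace Summit.QuantumFields.YangMills.BalabanUVNodes.N15KingModelRung.Analytic

open Literature.MathematicalPhysics.QuantumFieldTheory.LatticeDiamagneticInequality (Hopping)
open Literature.MathematicalPhysics.QuantumFieldTheory.Balaban1983to89.B5Prop11Plancherel (Tor fine)
open Literature.MathematicalPhysics.QuantumFieldTheory.King1986.Torus (lapF)
open Summit.QuantumFields.YangMills.BalabanUVNodes.N15KingModelRung.Covariant (covLapF det_covLapF_free det_lapF_pow_le_re_det_covLapF re_det_covLapF_le_pow re_det_covLapF_pos)
open Summit.QuantumFields.YangMills.BalabanUVNodes.N15KingModelRung.CovariantBlock (BlockTree fullOpU effLapU)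
open Summit.QuantumFields.YangMills.BalabanUVNodes.N15KingModelRung.TorusSpectral (det_lapF_pos log_det_lapF_bounds card_tor_fine_real)

variable {d : ℕ} {L : ℕ} [NeZero L] (T : BlockTree d L) (M : Fin (d + 1) → ℕ) [hM : ∀ μ, NeZero (M μ)]
variable {𝕜 : Type*} [RCLike 𝕜] {n : Type*} [Fintype n] [DecidableEq n]

/-! ## §0 Flat objects -/

section Flat

/-- THE FLAT VALUE: `det B(1) = det(c(−Δ)+m²)^{|n|}` (PART Ͱ-a `det_covLapF_free`). [cite: King1986, (2.13) p.653, (4.4) p.670] -/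
theorem re_det_covLapF_flat (c m2 : ℝ) :
    RCLike.re (covLapF (fine L M) c m2 (fun _ : Tor (fine L M) × Fin (d + 1) => (1 : Matrix n n 𝕜))).det = (lapF (fine L M) c m2).det ^ Fintype.card n := by
  rw [show (fun _ : Tor (fine L M) × Fin (d + 1) => (1 : Matrix n n 𝕜)) = Hopping.free from rfl, det_covLapF_free, ← RCLike.ofReal_pow, RCLike.ofReal_re]

omit [NeZero L] hM in
/-- The flat link field is unitary. [folklore] -/
theorem flat_mem_unitaryGroup : ∀ bd : Tor (fine L M) × Fin (d + 1), (fun _ : Tor (fine L M) × Fin (d + 1) => (1 : Matrix n n 𝕜)) bd ∈ Matrix.unitaryGroup n 𝕜 :=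
  fun _ => Submonoid.one_mem _

end Flat

/-! ## §1 The minimally coupled fine normalisation against its flat value -/

section Fine

variable {c m2 : ℝ} (hc : 0 ≤ c) (hm : 0 < m2)
include hc hm

/-- ★★ **THE DIAMAGNETIC SHIFT IS NON-NEGATIVE**: `0 ≤ ln det(−cΔ_U+m²) − ln det(c(−Δ)+m²)^{|n|}` at every unitary `U` (PART Ͱ-c's BFS inequality by name).
[cite: Balaban1982Higgs2, (3.37)–(3.38) p.591; King1986, (3.89) p.668] -/
theorem log_re_det_covLapF_sub_flat_nonneg {U : Tor (fine L M) × Fin (d + 1) → Matrix n n 𝕜} (hU : ∀ bd, U bd ∈ Matrix.unitaryGroup n 𝕜) :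
    0 ≤ Real.log (RCLike.re (covLapF (fine L M) c m2 U).det) - Real.log (RCLike.re (covLapF (fine L M) c m2 (fun _ : Tor (fine L M) × Fin (d + 1) => (1 : Matrix n n 𝕜))).det) := by
  rw [re_det_covLapF_flat M c m2, sub_nonneg]
  exact Real.log_le_log (pow_pos (det_lapF_pos (fine L M) hc hm) _) (det_lapF_pow_le_re_det_covLapF (fine L M) hc hm hU)

/-- ★★ **… AND AT MOST `N_η·ln(1 + 2(d+1)c∕m²)`** (every period `≥ 2`; PART Ͱ-c's AM–GM ceiling and PART Ε-k's floor `ln det(c(−Δ)+m²) ≥ |T_η|·ln m²`).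
[cite: King1986, (3.89) p.668, (4.4) p.670; Balaban1982Higgs2, (3.38) p.591] -/
theorem log_re_det_covLapF_sub_flat_le (hK2 : ∀ μ, 1 < fine L M μ) {U : Tor (fine L M) × Fin (d + 1) → Matrix n n 𝕜} (hU : ∀ bd, U bd ∈ Matrix.unitaryGroup n 𝕜) :
    Real.log (RCLike.re (covLapF (fine L M) c m2 U).det) - Real.log (RCLike.re (covLapF (fine L M) c m2 (fun _ : Tor (fine L M) × Fin (d + 1) => (1 : Matrix n n 𝕜))).det)
      ≤ Fintype.card (Tor (fine L M) × n) * Real.log (1 + 2 * ((d : ℝ) + 1) * c / m2) := by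
  rw [re_det_covLapF_flat M c m2]
  have hB := re_det_covLapF_pos (fine L M) (n := n) hc hm hU
  have hceil := re_det_covLapF_le_pow (fine L M) hK2 hc hm hU
  have hfree := (log_det_lapF_bounds (fine L M) hc hm).1
  have hsplit : Real.log (m2 + 2 * ((d : ℝ) + 1) * c) = Real.log m2 + Real.log (1 + 2 * ((d : ℝ) + 1) * c / m2) := by
    rw [← Real.log_mul hm.ne' (by positivity)]
    congr 1
    field_simp
  set Nf : ℝ := (Fintype.card (Tor (fine L M)) : ℝ) * Fintype.card n with hNf
  have hcard : (Fintype.card (Tor (fine L M) × n) : ℝ) = Nf := by rw [Fintype.card_prod]; push_cast; rfl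
  have h1 : Real.log (RCLike.re (covLapF (fine L M) c m2 U).det) ≤ Nf * Real.log m2 + Nf * Real.log (1 + 2 * ((d : ℝ) + 1) * c / m2) := by
    have h := Real.log_le_log hB hceil
    rw [Real.log_pow, hcard, hsplit, mul_add] at h
    exact h
  have hn : (0 : ℝ) ≤ Fintype.card n := Nat.cast_nonneg _
  have hfree' : Nf * Real.log m2 ≤ Fintype.card n * Real.log (lapF (fine L M) c m2).det := by
    have := mul_le_mul_of_nonneg_left hfree hn
    rw [hNf]
    linarith [this, show (Fintype.card (Tor (fine L M)) : ℝ) * Fintype.card n * Real.log m2 = Fintype.card n * ((Fintype.card (Tor (fine L M)) : ℝ) * Real.log m2) by ring]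
  rw [Real.log_pow, hcard]
  linarith

end Fine

/-! ## §2 The block term raises the fine normalisation, by at most `ln(1+a∕m²)` per block degree of freedom -/

section BlockTerm

variable {a c m2 : ℝ} (ha : 0 < a) (hc : 0 ≤ c) (hm : 0 < m2) {U : Tor (fine L M) × Fin (d + 1) → Matrix n n 𝕜} (hU : ∀ bd, U bd ∈ Matrix.unitaryGroup n 𝕜)
include ha hc hm hU

/-- ★★★ **`ln det(−cΔ_U+m²) ≤ ln det A₀(U)`**: the block term only RAISES the fine normalisation (`det A₀ = a^{N}det B∕det Δ_eff` with `det Δ_eff ≤ a^{N}`, PART Ϭ-a∕Ϭ-b).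
[cite: King1986, (2.13)–(2.14) p.653, (3.89)–(3.90) pp.668–669] -/
theorem log_re_det_fullOpU_ge_covLapF :
    Real.log (RCLike.re (covLapF (fine L M) c m2 U).det) ≤ Real.log (RCLike.re (fullOpU T M a c m2 U).det) := by
  have h := log_re_det_effLapU_eq T M ha hc hm hU
  have hceil := re_det_effLapU_le_pow T M ha hc hm hU
  have hΔ := re_det_effLapU_pos T M ha hc hm hU
  have hlog : Real.log (RCLike.re (effLapU T M a c m2 U).det) ≤ Fintype.card (Tor M × n) * Real.log a := by
    rw [← Real.log_pow]; exact Real.log_le_log hΔ hceil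
  linarith

/-- ★★★ **`ln det A₀(U) ≤ ln det(−cΔ_U+m²) + N·ln(1+a∕m²)`** — the rank-`N` block term raises the normalisation by at most `ln(1+a∕m²)` per BLOCK degree of freedom (PART Ϭ-b's floor
`det Δ_eff ≥ (a⁻¹+m⁻²)^{−N}`). [cite: King1986, (2.13)–(2.14) p.653, (3.89)–(3.90) pp.668–669, (4.33) p.674] -/
theorem log_re_det_fullOpU_le_covLapF_add :
    Real.log (RCLike.re (fullOpU T M a c m2 U).det) ≤ Real.log (RCLike.re (covLapF (fine L M) c m2 U).det) + Fintype.card (Tor M × n) * Real.log (1 + a / m2) := by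
  have h := log_re_det_effLapU_eq T M ha hc hm hU
  have hfloor := pow_le_re_det_effLapU T M ha hc hm hU
  have hβ : 0 < (a⁻¹ + m2⁻¹)⁻¹ := by positivity
  have hlog : Fintype.card (Tor M × n) * Real.log ((a⁻¹ + m2⁻¹)⁻¹) ≤ Real.log (RCLike.re (effLapU T M a c m2 U).det) := by
    rw [← Real.log_pow]; exact Real.log_le_log (pow_pos hβ _) hfloor
  have hlen : Real.log a - Real.log ((a⁻¹ + m2⁻¹)⁻¹) = Real.log (1 + a / m2) := by
    rw [Real.log_inv, sub_neg_eq_add, ← Real.log_mul ha.ne' (by positivity)]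
    congr 1
    field_simp
  nlinarith [hlen, hlog, h]

/-- ★★ **`|n|·ln det(c(−Δ)+m²) ≤ ln det A₀(U)`** — the fine fluctuation normalisation WITH the block term at ANY background is at least King's free minimally coupled one.
[cite: King1986, (2.13) p.653, (3.89) p.668, (4.4) p.670; Balaban1982Higgs2, (3.38) p.591] -/
theorem log_re_det_fullOpU_ge_flat_covLapF :
    Fintype.card n * Real.log (lapF (fine L M) c m2).det ≤ Real.log (RCLike.re (fullOpU T M a c m2 U).det) := by
  have h1 := log_re_det_covLapF_sub_flat_nonneg M hc hm hU
  have h2 := log_re_det_fullOpU_ge_covLapF T M ha hc hm hU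
  rw [re_det_covLapF_flat M c m2, Real.log_pow] at h1
  linarith

end BlockTerm

/-! ## §3 King's `ln[Z(U)Z(1)⁻¹]`: asymptotic diamagnetism with an `O(η^{d+1})` defect per fine site -/

section Diamagnetism

variable {a c m2 : ℝ} (ha : 0 < a) (hc : 0 ≤ c) (hm : 0 < m2) {U : Tor (fine L M) × Fin (d + 1) → Matrix n n 𝕜} (hU : ∀ bd, U bd ∈ Matrix.unitaryGroup n 𝕜)
include ha hc hm hU

/-- ★★★★ **ASYMPTOTIC DIAMAGNETISM OF KING's FLUCTUATION NORMALISATION**: `ln det A₀(U) − ln det A₀(1) ≥ −N·ln(1+a∕m²)` at EVERY unitary background — the diamagnetic inequality of the minimally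
coupled operator survives the block term up to a defect that is extensive in the BLOCK lattice only (PART Ϭ-a's split: non-negative fine shift minus PART Ϭ-b's bounded block-field shift).
[cite: King1986, (3.89)–(3.90) pp.668–669, (2.13)–(2.14) p.653, (4.33) p.674; Balaban1982Higgs2, (3.37)–(3.38) p.591] -/
theorem king_logZ_sub_flat_ge :
    -(Fintype.card (Tor M × n) * Real.log (1 + a / m2))
      ≤ Real.log (RCLike.re (fullOpU T M a c m2 U).det) - Real.log (RCLike.re (fullOpU T M a c m2 (fun _ => (1 : Matrix n n 𝕜))).det) := by
  have h1 := flat_mem_unitaryGroup (L := L) (d := d) M (n := n) (𝕜 := 𝕜)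
  rw [king_logZ_split T M ha hc hm hU h1]
  have hfine := log_re_det_covLapF_sub_flat_nonneg M hc hm hU
  have hblock := (abs_le.mp (abs_log_re_det_effLapU_sub_le T M ha hc hm hU h1)).2
  linarith

/-- ★★★★ **THE η-RATE OF THE DIAMAGNETIC DEFECT**: per fine site, `(ln det A₀(U) − ln det A₀(1))∕|T_η| ≥ −|n|·(L^{d+1})⁻¹·ln(1+a∕m²)` — the defect is `O(η^{d+1})` in King's spacing `η = L⁻¹`, uniformly in the
background, the volume and the fibre. [cite: King1986, (3.89)–(3.90) pp.668–669, (3.93) p.669, (2.11) p.653] -/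
theorem king_logZ_sub_flat_div_card_ge :
    -(Fintype.card n * ((L : ℝ) ^ (d + 1))⁻¹ * Real.log (1 + a / m2))
      ≤ (Real.log (RCLike.re (fullOpU T M a c m2 U).det) - Real.log (RCLike.re (fullOpU T M a c m2 (fun _ => (1 : Matrix n n 𝕜))).det)) / Fintype.card (Tor (fine L M)) := by
  have h := king_logZ_sub_flat_ge T M ha hc hm hU
  have hT : (0 : ℝ) < Fintype.card (Tor (fine L M)) := by exact_mod_cast Fintype.card_pos
  have hL : (0 : ℝ) < (L : ℝ) ^ (d + 1) := by have := NeZero.ne L; positivity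
  rw [le_div_iff₀ hT, card_tor_fine_real L M, Fintype.card_prod] at *
  push_cast at *
  have e : -(↑(Fintype.card n) * ((L : ℝ) ^ (d + 1))⁻¹ * Real.log (1 + a / m2)) * ((L : ℝ) ^ (d + 1) * ↑(Fintype.card (Tor M)))
      = -(↑(Fintype.card (Tor M)) * ↑(Fintype.card n) * Real.log (1 + a / m2)) := by
    field_simp
  rw [e]
  exact h

/-- ★★★ **THE CEILING** (every period `≥ 2`): `ln det A₀(U) − ln det A₀(1) ≤ N_η·ln(1+2(d+1)c∕m²) + N·ln(1+a∕m²)`. [cite: King1986, (3.89)–(3.90) pp.668–669, (4.4) p.670] -/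
theorem king_logZ_sub_flat_le (hK2 : ∀ μ, 1 < fine L M μ) :
    Real.log (RCLike.re (fullOpU T M a c m2 U).det) - Real.log (RCLike.re (fullOpU T M a c m2 (fun _ => (1 : Matrix n n 𝕜))).det)
      ≤ Fintype.card (Tor (fine L M) × n) * Real.log (1 + 2 * ((d : ℝ) + 1) * c / m2) + Fintype.card (Tor M × n) * Real.log (1 + a / m2) := by
  have h1 := flat_mem_unitaryGroup (L := L) (d := d) M (n := n) (𝕜 := 𝕜)
  rw [king_logZ_split T M ha hc hm hU h1]
  have hfine := log_re_det_covLapF_sub_flat_le M hc hm hK2 hU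
  have hblock := (abs_le.mp (abs_log_re_det_effLapU_sub_le T M ha hc hm hU h1)).1
  linarith

/-- ★★★ **TWO-SIDED**: `|ln det A₀(U) − ln det A₀(1)| ≤ N_η·ln(1+2(d+1)c∕m²) + N·ln(1+a∕m²)` (every period `≥ 2`). [cite: King1986, (3.89)–(3.90) pp.668–669] -/
theorem abs_king_logZ_sub_flat_le (hK2 : ∀ μ, 1 < fine L M μ) :
    |Real.log (RCLike.re (fullOpU T M a c m2 U).det) - Real.log (RCLike.re (fullOpU T M a c m2 (fun _ => (1 : Matrix n n 𝕜))).det)|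
      ≤ Fintype.card (Tor (fine L M) × n) * Real.log (1 + 2 * ((d : ℝ) + 1) * c / m2) + Fintype.card (Tor M × n) * Real.log (1 + a / m2) := by
  have h1 := king_logZ_sub_flat_ge T M ha hc hm hU
  have h2 := king_logZ_sub_flat_le T M ha hc hm hU hK2
  have hpos : 0 ≤ Fintype.card (Tor (fine L M) × n) * Real.log (1 + 2 * ((d : ℝ) + 1) * c / m2) :=
    mul_nonneg (Nat.cast_nonneg _) (Real.log_nonneg (le_add_of_nonneg_right (by positivity)))
  rw [abs_le]
  constructor <;> linarith

end Diamagnetism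

end Summit.QuantumFields.YangMills.BalabanUVNodes.N15KingModelRung.Analytic

end
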